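import Mathlib
import Literature.Computability.Complexity.Classes
import Literature.Computability.Complexity.Nondeterministic
import Literature.Computability.Complexity.BoolEncodings
import Literature.Computability.Complexity.CNF
import Literature.Computability.MetaComplexity.ProofSystems
import Literature.Computability.MetaComplexity.Frege
import HarnessLib

/-!
# PneNP / LatticeMagic — crux `Target` (stmt-PneNP-10709), line `SketchIdeator5`: shared definitions

Route-posited objects of the crux line `SketchIdeator5` (card `kpt-squeeze-ideal-lattice-leg`, ideator 5,
round 2; lead skeleton `Cruxes/Target/Lines/SketchIdeator5.lean`). This file is the single home of the
line's vocabulary, so that the stub files (`--supports stmt-PneNP-10709`) and the closing composition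
share ONE copy of every definition:

* §1 the Student–Teacher HARD-BIT VECTOR GAME for a function `g : {0,1}* → {0,1}*` with a predicate
  `B`: instances of `t` hidden strings, the student's view (images + revealed counterexamples),
  wrong coordinates, teachers, the history/proposals of a play, legality, winning, and the hardness
  statement `STGameHard g B` ("no `FP` student names the bit vector `(B(u_j))_j` within `O(1)` rounds")
  — consumed by `stub_game` (one-way + hard-core ⇒ game hard) and `stub_bridge`;
* §2 Krajíček's search problem `DD_V` for a Cook–Reckhow proof system `V` (given a `V`-proof of a
  DISJOINT disjunction, find a tautological disjunct) in the Student–Teacher model with `FP` students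
  and constantly many rounds — `DDInstance`, `ddView`, `DDLegal`, `DDWins`, the hardness statement
  `STHyp V` (= "`DD_V ∉ ST[FP, O(1)]`"), the strength condition `SimulatesEF V` ("`V ⊇ EF`", weak
  simulation of extended Frege over the tree's `textbookFrege`), Hypothesis (ST) `StrongST`, and
  `InjOnLengths g` (injectivity length by length, the content of the axioms `‖Inj_g‖ⁿ`).

Sources for the notions: J. Krajíček, *A proof complexity conjecture and the Incompleteness theorem*
companion = arXiv:2506.20221 (JSL), §1 (Student–Teacher computations, after Krajíček–Pudlák–Sgall
1990) and §2 (`DD_P`, Hypothesis (ST), strong pps = EF + p-time axioms); J. Krajíček, *Proof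
complexity* (CUP 2019) Def. 1.1.1 / 1.1.4 (proof systems, simulations; tree file `ProofSystems.lean`);
O. Goldreich, *Foundations of Cryptography I* (2001) Def. 2.5.1 (hard-core predicates; tree file
`OneWayFunctions.lean`). Everything here is vocabulary (route-posited objects, not cited facts); the
line's STUBS are proved — or not — in the sibling files `LatticeMagicTargetStub*.lean`.
-/

set_option linter.dupNamespace false -- `Summit.PneNP.PneNP.…`: summit = sub-problem (D-0017)

namespace Summit.PneNP.PneNP.Theorems.LatticeMagicTarget

open Literature.Computability.Complexity Literature.Computability.MetaComplexity
open _root_.Computability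

/-! ### 1. The Student–Teacher hard-bit vector game (card §First lemma) -/

/-- Flatten a list of strings with the tree's self-delimiting pairing. -/
def flat : List (List Bool) → List Bool
  | [] => []
  | x :: xs => boolPair x (flat xs)

/-- An instance: `t` hidden strings `u j` (the student is shown `w j = g (u j)`). -/
structure HBInstance (t : ℕ) where
  /-- the hidden preimages -/
  u : Fin t → List Bool

variable {t : ℕ}

/-- What the student sees before a round: the images and the counterexamples revealed so far
(coordinate index in unary, preimage). -/
def hbView (g : List Bool → List Bool) (I : HBInstance t) (hist : List (ℕ × List Bool)) :
    List Bool :=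
  boolPair (flat (List.ofFn fun j => g (I.u j)))
    (flat (hist.map fun p => boolPair (unaryEncodeNat p.1) p.2))

/-- Coordinate `j` of the proposal `v` is wrong: `B (u j) ≠ v_j` (junk bit `false` beyond `|v|`). -/
def Wrong (B : List Bool → Bool) (I : HBInstance t) (v : List Bool) (j : Fin t) : Prop :=
  B (I.u j) ≠ v.getD j false

/-- A teacher: given the round's proposal and the history, names a coordinate to reveal. -/
abbrev Teacher (t : ℕ) : Type := List Bool → List (ℕ × List Bool) → Fin t

/-- History after `r` rounds of the student `S` against the teacher `T`. -/
def hbHist (g : List Bool → List Bool) (S : List Bool → List Bool) (T : Teacher t)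
    (I : HBInstance t) : ℕ → List (ℕ × List Bool)
  | 0 => []
  | r + 1 =>
    let h := hbHist g S T I r
    let v := S (hbView g I h)
    let j := T v h
    h ++ [((j : ℕ), I.u j)]

/-- The student's proposal in round `r`. -/
def hbProposal (g : List Bool → List Bool) (S : List Bool → List Bool) (T : Teacher t)
    (I : HBInstance t) (r : ℕ) : List Bool :=
  S (hbView g I (hbHist g S T I r))

/-- The teacher is legal for `k` rounds: whenever the proposal has a wrong coordinate she
reveals a wrong one (which one is her choice — that is the adversarial freedom). -/
def HBLegal (g : List Bool → List Bool) (B : List Bool → Bool) (S : List Bool → List Bool)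
    (T : Teacher t) (I : HBInstance t) (k : ℕ) : Prop :=
  ∀ r < k, (∃ j, Wrong B I (hbProposal g S T I r) j) →
    Wrong B I (hbProposal g S T I r) (T (hbProposal g S T I r) (hbHist g S T I r))

/-- The student wins within `k` rounds: some proposal is entirely correct. -/
def HBWins (g : List Bool → List Bool) (B : List Bool → Bool) (S : List Bool → List Bool)
    (T : Teacher t) (I : HBInstance t) (k : ℕ) : Prop :=
  ∃ r < k, ∀ j, ¬ Wrong B I (hbProposal g S T I r) j

/-- The hard-bit vector game for `(g, B)` is hard for p-time students with constantly many
rounds: for every `k` and every `S ∈ FP` and arbitrarily large `n` there is an instance of `2k+2`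
hidden strings of length `n` and a legal teacher against which `S` does not win within `k` rounds. -/
def STGameHard (g : List Bool → List Bool) (B : List Bool → Bool) : Prop :=
  ∀ k : ℕ, ∀ S : List Bool → List Bool, S ∈ FP → ∀ n₀ : ℕ, ∃ n, n₀ ≤ n ∧
    ∃ I : HBInstance (2 * k + 2), (∀ j, (I.u j).length = n) ∧
      ∃ T : Teacher (2 * k + 2), HBLegal g B S T I k ∧ ¬ HBWins g B S T I k

/-! ### 2. Krajíček's hypothesis (ST) over Cook–Reckhow proof systems (arXiv:2506.20221 §2) -/

/-- The disjunction of a list of formulas (empty list ↦ the falsum `const false`). -/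
def bigDisj : List (PropForm ℕ) → PropForm ℕ
  | [] => PropForm.const false
  | [φ] => φ
  | φ :: l => PropForm.disj φ (bigDisj l)

/-- An input of the search problem `DD_V`: a `V`-proof `π` of a DISJOINT disjunction `⋁ l`. -/
structure DDInstance (V : List Bool → List Bool → Bool) where
  /-- the disjuncts -/
  l : List (PropForm ℕ)
  /-- the `V`-proof of their disjunction -/
  π : List Bool
  /-- no two disjuncts share an atom -/
  disjoint : l.Pairwise fun φ ψ => Disjoint φ.vars ψ.vars
  /-- `π : V ⊢ ⋁ l` -/
  proves : V (encodingPropForm.encode (bigDisj l)) π = true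

variable {V : List Bool → List Bool → Bool}

/-- The student's view: the instance and the counterexamples so far (index in unary, a falsifying
assignment presented as a bit list `a`, read as `x ↦ a.getD x false`). -/
def ddView (I : DDInstance V) (hist : List (ℕ × List Bool)) : List Bool :=
  boolPair (boolPair I.π (flat (I.l.map encodingPropForm.encode)))
    (flat (hist.map fun p => boolPair (unaryEncodeNat p.1) p.2))

/-- A DD-teacher: given the proposed index and the history, returns an assignment. -/
abbrev DDTeacher : Type := ℕ → List (ℕ × List Bool) → List Bool

/-- History after `r` rounds (the student answers an index in unary). -/
def ddHist (S : List Bool → List Bool) (T : DDTeacher) (I : DDInstance V) :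
    ℕ → List (ℕ × List Bool)
  | 0 => []
  | r + 1 =>
    let h := ddHist S T I r
    let i := unaryDecodeNat (S (ddView I h))
    h ++ [(i, T i h)]

/-- The index proposed in round `r`. -/
def ddProposal (S : List Bool → List Bool) (T : DDTeacher) (I : DDInstance V) (r : ℕ) : ℕ :=
  unaryDecodeNat (S (ddView I (ddHist S T I r)))

/-- Legal teacher for `k` rounds: a proposed non-tautology is answered by a falsifying assignment. -/
def DDLegal (S : List Bool → List Bool) (T : DDTeacher) (I : DDInstance V) (k : ℕ) : Prop :=
  ∀ r < k, ∀ φ, I.l[ddProposal S T I r]? = some φ → ¬ φ.IsTautology →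
    φ.eval (fun x => (T (ddProposal S T I r) (ddHist S T I r)).getD x false) = false

/-- The student wins within `k` rounds: some proposed disjunct is a tautology. -/
def DDWins (S : List Bool → List Bool) (T : DDTeacher) (I : DDInstance V) (k : ℕ) : Prop :=
  ∃ r < k, ∃ φ, I.l[ddProposal S T I r]? = some φ ∧ φ.IsTautology

/-- `DD_V ∉ ST[FP, O(1)]`: no p-time student solves `DD_V` in constantly many rounds
(Krajíček, arXiv:2506.20221 §2, Hypothesis (ST), for the system `V`). -/
def STHyp (V : List Bool → List Bool → Bool) : Prop :=
  ∀ k : ℕ, ∀ S : List Bool → List Bool, S ∈ FP →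
    ∃ I : DDInstance V, ∃ T : DDTeacher, DDLegal S T I k ∧ ¬ DDWins S T I k

/-- `V` is at least as strong as Extended Frege: every EF-proof (over the tree's `textbookFrege`)
of `φ` yields a `V`-proof of `encode φ` at most polynomially longer than the EF-proof's string code
(weak simulation, Krajíček 2019 Def. 1.1.4; "strong pps ⊇ EF", arXiv:2506.20221 §2). -/
def SimulatesEF (V : List Bool → List Bool → Bool) : Prop :=
  ∃ p : Polynomial ℕ, ∀ (π : List (PropForm ℕ)) (φ : PropForm ℕ), textbookFrege.IsEFProofOf π φ →
    ∃ π' : List Bool, π'.length ≤ p.eval (encodingPropForm.listBool.encode π).length ∧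
      V (encodingPropForm.encode φ) π' = true

/-- Hypothesis (ST) of arXiv:2506.20221 §2, typed: some Cook–Reckhow proof system for `TAUT` that
is at least as strong as EF has an ST-hard `DD` problem. -/
def StrongST : Prop :=
  ∃ V : List Bool → List Bool → Bool, IsProofSystemFor V TAUT ∧ SimulatesEF V ∧ STHyp V

/-- Injectivity length by length (the content of the propositional axioms `‖Inj_g‖ⁿ`). -/
def InjOnLengths (g : List Bool → List Bool) : Prop :=
  ∀ x y : List Bool, x.length = y.length → g x = g y → x = y

/-! ### 3. Two structural facts about the vocabulary (registered sub-goals of stmt-PneNP-10709) -/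

/-- `STHyp` is monotone along pointwise-weaker verifiers (every `V`-proof is a `V'`-proof): the step
of Krajíček's Thm 4.1 (arXiv:2506.20221 §4, step (1)) that passes from the (ST)-witness to a
p-bounded extension under `NP = coNP` — the student's view does not mention the verifier. -/
theorem stHyp_mono (V V' : List Bool → List Bool → Bool) (hVV' : ∀ x π, V x π = true → V' x π = true)
    (h : STHyp V) : STHyp V' := by
  intro k S hS
  obtain ⟨I, T, hlegal, hwin⟩ := h k S hS
  let I' : DDInstance V' := ⟨I.l, I.π, I.disjoint, hVV' _ _ I.proves⟩
  have hview : ∀ hist, ddView I' hist = ddView I hist := fun _ => rfl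
  have hhist : ∀ r, ddHist S T I' r = ddHist S T I r := by
    intro r
    induction r with
    | zero => rfl
    | succ r ih => simp only [ddHist, ih, hview]
  have hprop : ∀ r, ddProposal S T I' r = ddProposal S T I r := by
    intro r
    simp only [ddProposal, hhist, hview]
  refine ⟨I', T, ?_, ?_⟩
  · intro r hr φ hφ hnt
    have := hlegal r hr φ (by simpa [hprop] using hφ) hnt
    simpa [hprop, hhist] using this
  · rintro ⟨r, hr, φ, hφ, hφt⟩
    exact hwin ⟨r, hr, φ, by simpa [hprop] using hφ, hφt⟩

/-- With ZERO rounds no student wins the hard-bit game and every teacher is legal, so `STGameHard`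
at `k = 0` only asks for instances of every large length (sanity check of the quantifier shape: the
content of the definition is in `k ≥ 1`). -/
theorem not_hbWins_zero {t : ℕ} (g : List Bool → List Bool) (B : List Bool → Bool)
    (S : List Bool → List Bool) (T : Teacher t) (I : HBInstance t) : ¬ HBWins g B S T I 0 := by
  rintro ⟨r, hr, -⟩
  exact Nat.not_lt_zero r hr

end Summit.PneNP.PneNP.Theorems.LatticeMagicTarget
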